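import Summits.CriticalPhenomena.CardyFormulaZ2.Theses.CardyDualCurrent
import Literature.Probability.RandomPlanarGeometry.CaratheodoryHalfPlaneProofs
import Literature.Probability.RandomPlanarGeometry.ConformalMapProofs
import Literature.Probability.RandomPlanarGeometry.JordanDomainProofs
import Literature.Analysis.Complex.HolomorphicPrimitives

/-!
# `TemplateCanonicalLimit` (stmt-CriticalPhenomena-11393) is not junk-reachable

Route `CardyDualCurrent`, sub-problem `CriticalPhenomena/CardyFormulaZ2`. The refuter audit of the
support item `TemplateCanonicalLimit` (an `∃`-template statement) left one vacuity hinge open: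
should no `ZdDiscretisationFamily` exist, or no chordal uniformizer, or no holomorphic cube root
`q` of `ψ'/ψ`, the inner `∀` would never fire and the EMPTY template (`m = 0`, observable `≡ 0`)
would witness the item "for the wrong reason". This file closes the analytic half of that hinge
in Lean, from theorems of the tree, and reduces the rest to the existence of ONE discretisation
family (proved in the tree: `DiscretisationFamilyExists_proof`, stmt-9644, whose import cone is
kept out of this file; the discharge is the companion file `…NonvacuousFamilies`):

* `exists_cube_root_of_jordanDomain` — zero-free holomorphic functions on a Jordan domain have
  holomorphic cube roots (hole-free complement, Conway VIII.2.2 via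
  `Complex.exists_eq_exp_of_forall_isExactOn`);
* `templateCanonicalLimit_target_nonempty` — for EVERY Dobrushin domain there are a chordal
  uniformizer (`MarkedDomain.exists_isChordalUniformizing_holds`) and a holomorphic cube root `q`
  of `ψ'/ψ` (`ψ = φ⁻¹`), and every such `q` is ZERO-FREE (`ψ` maps into `ℍ ∌ 0`, `ψ' ≠ 0` by
  `ConformalEquiv.deriv_ne_zero_holds`);
* `templateCanonicalLimit_witness_frequently_ne_zero` — consequently the observable of any
  witness template is NOT eventually zero, as `δ → 0⁺`, at any point of any Dobrushin domain
  along any discretisation family, for either edge type (a zero sequence cannot tend to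
  `q w ≠ 0`);
* `templateCanonicalLimit_iff_exists_pos_of_family` — hence, as soon as ONE Dobrushin domain
  carries ONE discretisation family, the `∃` of the item may be restricted to templates with
  `m ≥ 1` terms: the empty template is not a witness.

So the item is exactly as strong as it reads: the `∃`-template, family/chordal form of
Duminil-Copin–Smirnov 2012 Conjecture 8.7 / Smirnov 2010 Conjecture 2.4 at `q = 1` (open).
-/

noncomputable section

namespace Summit.CriticalPhenomena.CardyFormulaZ2.Theorems

open Summit.CriticalPhenomena.CardyFormulaZ2.Theses.CardyDualCurrent
open Literature.Probability.LatticeModels Literature.Probability.RandomPlanarGeometry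
open Literature.Probability.Percolation
open Filter Topology MeasureTheory Set

/-- **Holomorphic cube roots on Jordan domains.** A zero-free holomorphic function on (the carrier
of) a Jordan domain has a holomorphic cube root: the complement `ℂ \ D` is connected
(`JordanDomain.isPreconnected_compl`) and unbounded, so `D` has no holes, every holomorphic
function on it has a primitive and zero-free ones have logarithms (Conway, *Functions of One
Complex Variable I* (1978), Thm. VIII.2.2); `q = exp (g/3)` for `f = exp g`.
[cite: Conway1978, Ch. VIII Thm. 2.2] -/
theorem exists_cube_root_of_jordanDomain (D : JordanDomain) {f : ℂ → ℂ}
    (hf : DifferentiableOn ℂ f D.carrier) (hf0 : ∀ z ∈ D.carrier, f z ≠ 0) :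
    ∃ q : ℂ → ℂ, DifferentiableOn ℂ q D.carrier ∧ ∀ z ∈ D.carrier, q z ^ 3 = f z := by
  have hG := D.isOpen
  have hGc := D.isConnected.isPreconnected
  have hGh : ∀ a ∈ D.carrierᶜ, ¬ Bornology.IsBounded (connectedComponentIn D.carrierᶜ a) := by
    intro a ha hb
    have hsub : D.carrierᶜ ⊆ connectedComponentIn D.carrierᶜ a :=
      D.isPreconnected_compl.subset_connectedComponentIn ha subset_rfl
    have huniv : Bornology.IsBounded (univ : Set ℂ) := by
      rw [← union_compl_self D.carrier]
      exact D.isBounded.union (hb.subset hsub)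
    exact NormedSpace.unbounded_univ ℝ ℂ huniv
  obtain ⟨g, hgd, hg⟩ := Complex.exists_eq_exp_of_forall_isExactOn hG hGc
    (fun _ hf' => Complex.isExactOn_of_compl hG hGc hGh hf') hf hf0
  refine ⟨fun z => Complex.exp (g z / 3), (hgd.div_const 3).cexp, fun z hz => ?_⟩
  have h3 : Complex.exp (g z / 3) ^ 3 = Complex.exp (g z) := by
    rw [← Complex.exp_nat_mul]
    congr 1
    push_cast
    ring
  rw [h3, hg z hz]

/-- **The target of `TemplateCanonicalLimit` exists and is zero-free in every Dobrushin domain.**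
For every Dobrushin domain `(D; a, b)` there are a chordal uniformizer `φ : (ℍ; 0, ∞) → (D; a, b)`
(`MarkedDomain.exists_isChordalUniformizing_holds`) and a holomorphic `q` on `D` with `q³ = ψ'/ψ`,
`ψ = φ⁻¹` (`exists_cube_root_of_jordanDomain`); and every such `q` is zero-free, since `ψ` maps `D`
into `ℍ ∌ 0` and `ψ' ≠ 0` (`ConformalEquiv.deriv_ne_zero_holds`). [folklore] -/
theorem templateCanonicalLimit_target_nonempty (D : DobrushinDomain) :
    ∃ (φ : ConformalEquiv UpperHalfPlane.upperHalfPlaneSet D.carrier) (q : ℂ → ℂ),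
      D.IsChordalUniformizing φ ∧ DifferentiableOn ℂ q D.carrier ∧
      (∀ w ∈ D.carrier, q w ^ 3 = deriv φ.symm w / φ.symm w) ∧
      ∀ w ∈ D.carrier, q w ≠ 0 := by
  obtain ⟨φ, hφ⟩ := MarkedDomain.exists_isChordalUniformizing_holds D
  -- `ψ = φ.symm` is holomorphic and zero-free with zero-free derivative on `D`
  have hψd : DifferentiableOn ℂ φ.symm D.carrier := φ.symm.differentiableOn_coe
  have hψ0 : ∀ w ∈ D.carrier, φ.symm w ≠ 0 := by
    intro w hw h0
    have hmem : 0 < (φ.symm w).im := φ.symm_mapsTo hw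
    rw [h0] at hmem
    simp at hmem
  have hψ'0 : ∀ w ∈ D.carrier, deriv φ.symm w ≠ 0 := fun w hw =>
    ConformalEquiv.deriv_ne_zero_holds φ.symm D.isOpen hw
  have hψ'd : DifferentiableOn ℂ (deriv φ.symm) D.carrier :=
    (hψd.analyticOnNhd D.isOpen).deriv.differentiableOn
  have hfd : DifferentiableOn ℂ (fun w => deriv φ.symm w / φ.symm w) D.carrier :=
    hψ'd.div hψd hψ0
  have hf0 : ∀ w ∈ D.carrier, deriv φ.symm w / φ.symm w ≠ 0 := fun w hw =>
    div_ne_zero (hψ'0 w hw) (hψ0 w hw)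
  obtain ⟨q, hqd, hq⟩ := exists_cube_root_of_jordanDomain D.toJordanDomain hfd hf0
  refine ⟨φ, q, hφ, hqd, hq, fun w hw hq0 => hf0 w hw ?_⟩
  rw [← hq w hw, hq0]
  norm_num

/-- **The observable of a witness template is nowhere eventually zero.** If `(r, m, z, s, g, C)`
satisfies the body of `TemplateCanonicalLimit` (stated verbatim as the hypothesis `h`), then for
every Dobrushin domain `D`, every discretisation family `E` of it, both edge types `i` and every
point `w ∈ D`, the template expectation `G_{E δ}(⌊w/δ⌋, i)` is non-zero for `δ → 0⁺` frequently:
otherwise `θ_δ · C · δ^{-1/3} · G → q w` along an eventually-zero sequence would force `q w = 0`,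
contradicting `templateCanonicalLimit_target_nonempty`. In particular no template with
identically vanishing observable (e.g. the empty one) witnesses the item. [folklore] -/
theorem templateCanonicalLimit_witness_frequently_ne_zero {r m : ℕ}
    {z : Fin 2 → Fin m → Literature.Probability.LatticeModels.MedialVertex} {s : Fin 2 → Fin m → ℝ}
    {g : Fin 2 → Fin m → Set Literature.Probability.LatticeModels.MedialVertex → ℂ} {C : ℝ}
    (h : 0 < C ∧ (∀ i k, Literature.Probability.LatticeModels.medialGraph.edist s((0 : Literature.Probability.LatticeModels.Site 2), Pi.single i 1) (z i k) ≤ (r : ℕ∞)) ∧ (let G : Literature.Probability.LatticeModels.DiscreteDobrushin → Literature.Probability.LatticeModels.Site 2 → Fin 2 → ℂ := fun D x i => ∫ cfg, (∑ k, g i k {e | Literature.Probability.LatticeModels.medialGraph.edist s((0 : Literature.Probability.LatticeModels.Site 2), Pi.single i 1) e ≤ (r : ℕ∞) ∧ Sym2.map (· + x) e ∈ cfg} * Literature.Probability.LatticeModels.passageSum (Literature.Probability.LatticeModels.fkInterface D cfg) D.δ (s i k) (Sym2.map (· + x) (z i k))) ∂(Literature.Probability.Percolation.bondPercolation (Literature.Probability.LatticeModels.zdGraph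 2) Literature.Probability.Percolation.half); ∀ (D : Literature.Probability.RandomPlanarGeometry.DobrushinDomain) (E : ℝ → Literature.Probability.LatticeModels.DiscreteDobrushin), Literature.Probability.LatticeModels.ZdDiscretisationFamily D E → ∀ (φ : Literature.Probability.RandomPlanarGeometry.ConformalEquiv UpperHalfPlane.upperHalfPlaneSet D.carrier), D.IsChordalUniformizing φ → ∀ q : ℂ → ℂ, DifferentiableOn ℂ q D.carrier → (∀ w ∈ D.carrier, q w ^ 3 = deriv φ.symm w / φ.symm w) → ∃ θ : ℝ → ℂ, (∀ δ, ‖θ δ‖ = 1) ∧ ∀ i : Fin 2, TendstoLocallyUniformlyOn (fun (δ : ℝ) (w : ℂ) => θ δ * C * ((δ ^ (-(1 / 3 : ℝ)) : ℝ) : ℂ) * G (E δ) (fun j => ⌊(if j = 0 then w.re else w.im) / δ⌋) i) q (𝓝[>] (0 : ℝ)) D.carrier))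
    (D : DobrushinDomain) {E : ℝ → DiscreteDobrushin} (hE : ZdDiscretisationFamily D E)
    (i : Fin 2) {w : ℂ} (hw : w ∈ D.carrier) :
    ∃ᶠ δ in 𝓝[>] (0 : ℝ),
      (∫ cfg, (∑ k, g i k {e | medialGraph.edist s((0 : Site 2), Pi.single i 1) e ≤ (r : ℕ∞) ∧
          Sym2.map (· + (fun j => ⌊(if j = 0 then w.re else w.im) / δ⌋ : Site 2)) e ∈ cfg} *
        Literature.Probability.LatticeModels.passageSum (fkInterface (E δ) cfg) (E δ).δ (s i k)
          (Sym2.map (· + (fun j => ⌊(if j = 0 then w.re else w.im) / δ⌋ : Site 2)) (z i k)))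
        ∂(bondPercolation (zdGraph 2) half)) ≠ 0 := by
  obtain ⟨-, -, hlim⟩ := h
  obtain ⟨φ, q, hφ, hqd, hq3, hq0⟩ := templateCanonicalLimit_target_nonempty D
  obtain ⟨θ, -, hconv⟩ := hlim D E hE φ hφ q hqd hq3
  have ht := (hconv i).tendsto_at hw
  refine Filter.not_eventually.mp fun hev => hq0 w hw ?_
  refine tendsto_nhds_unique (ht.congr' ?_) (tendsto_const_nhds (x := (0 : ℂ)))
  filter_upwards [hev] with δ hδ
  rw [hδ, mul_zero]

/-- **`TemplateCanonicalLimit` with `m ≥ 1`, given one discretisation family.** As soon as some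
Dobrushin domain `D₀` carries some `ZdDiscretisationFamily` (true for every Dobrushin domain:
`DiscretisationFamilyExists_proof`, stmt-9644, discharged in the companion file
`CardyDualCurrentTemplateCanonicalLimitNonvacuousFamilies`), the `∃` of the item may be restricted
to templates with at least one term: a witness with `m = 0` has observable
`∫ (∑_{k : Fin 0} …) = 0`, eventually (hence not frequently non-) zero at a point of `D₀`,
contradicting `templateCanonicalLimit_witness_frequently_ne_zero`. So the item is not reachable
through the empty template. [folklore] -/
theorem templateCanonicalLimit_iff_exists_pos_of_family {D₀ : DobrushinDomain}
    {E₀ : ℝ → DiscreteDobrushin} (hE₀ : ZdDiscretisationFamily D₀ E₀) :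
    TemplateCanonicalLimit ↔
    ∃ (r m : ℕ) (z : Fin 2 → Fin m → Literature.Probability.LatticeModels.MedialVertex) (s : Fin 2 → Fin m → ℝ) (g : Fin 2 → Fin m → Set Literature.Probability.LatticeModels.MedialVertex → ℂ) (C : ℝ), 0 < m ∧ (0 < C ∧ (∀ i k, Literature.Probability.LatticeModels.medialGraph.edist s((0 : Literature.Probability.LatticeModels.Site 2), Pi.single i 1) (z i k) ≤ (r : ℕ∞)) ∧ (let G : Literature.Probability.LatticeModels.DiscreteDobrushin → Literature.Probability.LatticeModels.Site 2 → Fin 2 → ℂ := fun D x i => ∫ cfg, (∑ k, g i k {e | Literature.Probability.LatticeModels.medialGraph.edist s((0 : Literature.Probability.LatticeModels.Site 2), Pi.single i 1) e ≤ (r : ℕ∞) ∧ Sym2.map (· + x) e ∈ cfg} * Literature.Probability.LatticeModels.passageSum (Literature.Probability.LatticeModels.fkInterface D cfg) D.δ (s i k) (Sym2.map (· + x) (z i k))) ∂(Literature.Probability.Percolation.bondPercolation (Literature.Probability.LatticeModels.zdGraph 2) Literature.Probability.Percolation.half); ∀ (D : Literature.Probability.RandomPlanarGeometry.DobrushinDomain)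 (E : ℝ → Literature.Probability.LatticeModels.DiscreteDobrushin), Literature.Probability.LatticeModels.ZdDiscretisationFamily D E → ∀ (φ : Literature.Probability.RandomPlanarGeometry.ConformalEquiv UpperHalfPlane.upperHalfPlaneSet D.carrier), D.IsChordalUniformizing φ → ∀ q : ℂ → ℂ, DifferentiableOn ℂ q D.carrier → (∀ w ∈ D.carrier, q w ^ 3 = deriv φ.symm w / φ.symm w) → ∃ θ : ℝ → ℂ, (∀ δ, ‖θ δ‖ = 1) ∧ ∀ i : Fin 2, TendstoLocallyUniformlyOn (fun (δ : ℝ) (w : ℂ) => θ δ * C * ((δ ^ (-(1 / 3 : ℝ)) : ℝ) : ℂ) * G (E δ) (fun j => ⌊(if j = 0 then w.re else w.im) / δ⌋) i) q (𝓝[>] (0 : ℝ)) D.carrier)) := by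
  constructor
  · rintro ⟨r, m, z, s, g, C, h⟩
    refine ⟨r, m, z, s, g, C, Nat.pos_of_ne_zero ?_, h⟩
    rintro rfl
    -- the empty template: observable identically zero, contradicting non-degeneracy at a
    -- point of `D₀`
    obtain ⟨w, hw⟩ := D₀.toJordanDomain.nonempty
    have hfr := templateCanonicalLimit_witness_frequently_ne_zero h D₀ hE₀ 0 hw
    simp at hfr
  · rintro ⟨r, m, z, s, g, C, -, h⟩
    exact ⟨r, m, z, s, g, C, h⟩

end Summit.CriticalPhenomena.CardyFormulaZ2.Theorems

end
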